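import Literature.Analysis.FluidPDE.CaloricDuhamelRepresentation
import Literature.Analysis.FluidPDE.CaloricTestFieldCalculus
import Literature.Analysis.FluidPDE.CKNPressureDuality
import HarnessLib

/-!
# The caloric duality identity for distributional Navier–Stokes solutions

Analysis/FluidPDE support file for the discharge of the named fact
`Literature.Analysis.FluidPDE.NSBoundedInteriorContinuity` (`NSBoundedInteriorRegularity.lean`;
Seregin–Šverák 2009, §2: bounded distributional solutions with `L_{3/2}` pressure are continuous
inside). This file proves the **master identity** of the duality argument
(`integral_cutoff_mul_test_mul_inner_eq`): for a distributional solution `(u, p)` of the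
Navier–Stokes system (`ν = 1`, no force) on an open region `Q ⊆ ℝ × ℝ³`, a space–time cut-off
`φ ∈ C_c^∞(Q)`, a scalar space–time test function `g` on `ℝ × ℝ³`, a vector `c`, an orthonormal
basis `(eᵢ)` and radii `0 < r₀ < r₁`, with `η = 𝒰[g]` (the backward caloric Duhamel integral),
`Ξ = 𝒰[∂_c N[g]]` (`N` the truncated Newtonian potential at radii `(r₀, r₁)`) and
`L = 𝒰[Λ[∂_c g]]` (`Λ` its smoothing remainder),

  `∫_Q φ g ⟪u, c⟫ = ∫_Q (∂ₜφ + Δφ) u_c η + ∑ᵢ ∫_Q 2∂ᵢφ u_c ∂ᵢη + ∑ᵢ ∫_Q ∂ᵢφ uᵢu_c η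
    + ∑ᵢ ∫_Q φ uᵢu_c ∂ᵢη + ∫_Q ∂_cφ p η + ∫_Q φ p L - ∫_Q Δφ p Ξ - ∑ᵢ ∫_Q 2∂ᵢφ p ∂ᵢΞ
    - ∑ᵢⱼ ∫_Q φ uᵢuⱼ ∂ⱼ∂ᵢΞ - ∑ᵢⱼ ∫_Q ∂ⱼ∂ᵢφ uᵢuⱼ Ξ - ∑ᵢⱼ ∫_Q 2∂ⱼφ uⱼuᵢ ∂ᵢΞ`

(`u_c = ⟪u, c⟫`, `uᵢ = ⟪u, eᵢ⟫`). It is obtained by testing the momentum equation with the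
vector field `ψ = (φη) c` — using the backward heat equation `∂ₜη + Δη = -g` — which leaves the
single pressure term `∫_Q φ p ∂_cη` carrying a derivative of `η`, and by eliminating that term
through the pressure equation `∫_Q (D²ϑ(u,u) + pΔϑ) = 0` (the tree's
`IsDistributionalNSSolutionOn.integral_hessian_add_pressure_laplacian_eq_zero`, Lemarié-Rieusset
2016, (13.19)) tested with `ϑ = φΞ`, using `ΔΞ = ∂_cη - L`
(`CaloricDuhamelRepresentation.laplacian_heatDuhamelBack_fderiv_newtonNearPotential`). Every term
on the right is the integral over `Q` of (a derivative of the cut-off) × (a monomial of degree ≤ 2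
in `u`, or `p`) × (a derivative of `η`, `Ξ` or `L`), which is the shape consumed by the
continuity argument of `NSBoundedInteriorRegularityProofs.lean`. Everything here is proved;
nothing is specific to bounded solutions.

## References

* G. Seregin, V. Šverák, Comm. PDE 34 (2009) = arXiv:0804.1803, §2. [`SereginSverak2009`]
* P. G. Lemarié-Rieusset, *The Navier–Stokes Problem in the 21st Century* (2016), (13.19).
  [`LemarieRieusset2016`]
-/

noncomputable section

open MeasureTheory Set Function Filter TopologicalSpace Metric
open scoped Topology RealInnerProductSpace Laplacian ENNReal

namespace Literature.Analysis.FluidPDE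

section General

variable {E : Type*} [NormedAddCommGroup E] [InnerProductSpace ℝ E] [FiniteDimensional ℝ E]
  [MeasurableSpace E] [BorelSpace E]

/-! ### Continuity of slice derivatives of jointly smooth fields -/

omit [MeasurableSpace E] [BorelSpace E] [FiniteDimensional ℝ E] in
/-- A jointly smooth field is smooth on every time set. [folklore] -/
theorem isSmoothSpaceTimeOn_of_contDiff_uncurry {H : ℝ → E → ℝ}
    (hH : ContDiff ℝ ((⊤ : ℕ∞) : WithTop ℕ∞) (uncurry H)) : IsSmoothSpaceTimeOn univ H :=
  hH.contDiffOn

omit [MeasurableSpace E] [BorelSpace E] [FiniteDimensional ℝ E] in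
/-- The slice derivative field `(t, x) ↦ ∂ᵥH(t,·)(x)` of a jointly smooth field is jointly smooth.
[folklore] -/
theorem contDiff_uncurry_fderiv_slice_apply {H : ℝ → E → ℝ}
    (hH : ContDiff ℝ ((⊤ : ℕ∞) : WithTop ℕ∞) (uncurry H)) (v : E) :
    ContDiff ℝ ((⊤ : ℕ∞) : WithTop ℕ∞) (uncurry fun t x => fderiv ℝ (H t) x v) := by
  have h := (isSmoothSpaceTimeOn_of_contDiff_uncurry hH).isSmoothSpaceTimeOn_fderiv_apply isOpen_univ v
  have h' : ContDiffOn ℝ ((⊤ : ℕ∞) : WithTop ℕ∞) (uncurry fun t x => fderiv ℝ (H t) x v) (univ ×ˢ univ) := h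
  rwa [univ_prod_univ, contDiffOn_univ] at h'

omit [MeasurableSpace E] [BorelSpace E] [FiniteDimensional ℝ E] in
/-- The slice derivative field of a jointly smooth field is jointly continuous. [folklore] -/
theorem continuous_fderiv_slice_of_contDiff {H : ℝ → E → ℝ}
    (hH : ContDiff ℝ ((⊤ : ℕ∞) : WithTop ℕ∞) (uncurry H)) (v : E) :
    Continuous fun z : ℝ × E => fderiv ℝ (H z.1) z.2 v :=
  (contDiff_uncurry_fderiv_slice_apply hH v).continuous

/-! ### Integrability of the terms on `Q` -/

/-- **Integrability of a duality term**: `T · m · X` is integrable on `Q` when `T` and `X` are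
continuous, `T` vanishes off a compact `K ⊆ Q`, and `m` is integrable on `K`. [folklore] -/
theorem integrableOn_test_mul_mul (Q : Opens (ℝ × E)) {K : Set (ℝ × E)} (hK : IsCompact K)
    {T m X : ℝ × E → ℝ} (hT : Continuous T)
    (hT0 : ∀ z, z ∉ K → T z = 0) (hm : IntegrableOn m K volume) (hX : Continuous X) :
    IntegrableOn (fun z => T z * m z * X z) (Q : Set (ℝ × E)) volume := by
  -- on `K`: bounded continuous factor times an integrable one
  obtain ⟨B, hB⟩ := hK.exists_bound_of_continuousOn ((hT.mul hX).continuousOn)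
  have hKi : IntegrableOn (fun z => T z * m z * X z) K volume := by
    have : (fun z => T z * m z * X z) = fun z => (T z * X z) * m z := by funext z; ring
    rw [this]
    refine hm.bdd_mul (c := B) ((hT.mul hX).aestronglyMeasurable) ?_
    exact (ae_restrict_iff' hK.measurableSet).2 (Eventually.of_forall fun z hz => hB z hz)
  refine hKi.of_forall_sdiff_eq_zero Q.isOpen.measurableSet fun z hz => ?_
  rw [hT0 z hz.2]; ring

end General

/-! ### The master identity (dimension three) -/

section Master

variable {Q : Opens (ℝ × EuclideanSpace ℝ (Fin 3))}
  {u : ℝ → EuclideanSpace ℝ (Fin 3) → EuclideanSpace ℝ (Fin 3)} {p : ℝ → EuclideanSpace ℝ (Fin 3) → ℝ}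
  {φ g η Ξ L : ℝ → EuclideanSpace ℝ (Fin 3) → ℝ} {r₀ r₁ : ℝ} {c : EuclideanSpace ℝ (Fin 3)}
  {ι : Type*} [Fintype ι]

/-- The basic monomials are integrable on the support of the cut-off: `⟪u, c⟫`. [folklore] -/
theorem integrableOn_inner_of_locallyIntegrableOn {K : Set (ℝ × EuclideanSpace ℝ (Fin 3))}
    (hK : IsCompact K) (hKQ : K ⊆ (Q : Set (ℝ × EuclideanSpace ℝ (Fin 3))))
    (hu : LocallyIntegrableOn (uncurry u) (Q : Set (ℝ × EuclideanSpace ℝ (Fin 3))) volume)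
    (c : EuclideanSpace ℝ (Fin 3)) :
    IntegrableOn (fun z => ⟪u z.1 z.2, c⟫) K volume :=
  (hu.integrableOn_compact_subset hKQ hK).inner_const c

/-- The basic monomials are integrable on the support of the cut-off: `⟪u, a⟫⟪u, b⟫`. [folklore] -/
theorem integrableOn_inner_mul_inner_of_locallyIntegrableOn {K : Set (ℝ × EuclideanSpace ℝ (Fin 3))}
    (hK : IsCompact K) (hKQ : K ⊆ (Q : Set (ℝ × EuclideanSpace ℝ (Fin 3))))
    (hu : LocallyIntegrableOn (uncurry u) (Q : Set (ℝ × EuclideanSpace ℝ (Fin 3))) volume)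
    (hu2 : LocallyIntegrableOn (fun z => ‖uncurry u z‖ ^ 2) (Q : Set (ℝ × EuclideanSpace ℝ (Fin 3))) volume)
    (a b : EuclideanSpace ℝ (Fin 3)) :
    IntegrableOn (fun z => ⟪u z.1 z.2, a⟫ * ⟪u z.1 z.2, b⟫) K volume := by
  have hm : AEStronglyMeasurable (fun z => ⟪u z.1 z.2, a⟫ * ⟪u z.1 z.2, b⟫) (volume.restrict K) := by
    have h := (hu.integrableOn_compact_subset hKQ hK).aestronglyMeasurable
    exact (h.inner_const (c := a)).mul (h.inner_const (c := b))
  refine ((hu2.integrableOn_compact_subset hKQ hK).const_mul (‖a‖ * ‖b‖)).mono' hm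
    (Eventually.of_forall fun z => ?_)
  rw [norm_mul]
  calc ‖(⟪u z.1 z.2, a⟫ : ℝ)‖ * ‖(⟪u z.1 z.2, b⟫ : ℝ)‖ ≤ (‖u z.1 z.2‖ * ‖a‖) * (‖u z.1 z.2‖ * ‖b‖) :=
        mul_le_mul (norm_inner_le_norm _ _) (norm_inner_le_norm _ _) (norm_nonneg _) (by positivity)
    _ = ‖a‖ * ‖b‖ * ‖uncurry u z‖ ^ 2 := by simp only [uncurry]; ring

variable (hns : IsDistributionalNSSolutionOn Q 1 0 u p) (hφ : IsSpaceTimeTestOn Q φ)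
  (hg : IsSpaceTimeTestOn (⊤ : Opens (ℝ × EuclideanSpace ℝ (Fin 3))) g)
  (h₀ : 0 < r₀) (h₁ : r₀ < r₁) (b : OrthonormalBasis ι ℝ (EuclideanSpace ℝ (Fin 3)))
  (hη : η = heatDuhamelBack 1 g)
  (hΞ : Ξ = heatDuhamelBack 1 (fun t y => fderiv ℝ (newtonNearPotential r₀ r₁ (g t)) y c))
  (hL : L = heatDuhamelBack 1 (fun t y => newtonFarSmoothing r₀ r₁ (fun y' => fderiv ℝ (g t) y' c) y))

include hg h₀ h₁ in
omit [Fintype ι] in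
/-- `η`, `Ξ`, `L` are jointly smooth. [folklore] -/
theorem contDiff_uncurry_caloric_fields (hη : η = heatDuhamelBack 1 g)
    (hΞ : Ξ = heatDuhamelBack 1 (fun t y => fderiv ℝ (newtonNearPotential r₀ r₁ (g t)) y c))
    (hL : L = heatDuhamelBack 1 (fun t y => newtonFarSmoothing r₀ r₁ (fun y' => fderiv ℝ (g t) y' c) y)) :
    ContDiff ℝ ((⊤ : ℕ∞) : WithTop ℕ∞) (uncurry η) ∧ ContDiff ℝ ((⊤ : ℕ∞) : WithTop ℕ∞) (uncurry Ξ) ∧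
      ContDiff ℝ ((⊤ : ℕ∞) : WithTop ℕ∞) (uncurry L) := by
  refine ⟨?_, ?_, ?_⟩
  · rw [hη]; exact hg.contDiff_uncurry_heatDuhamelBack_infty one_pos
  · rw [hΞ]
    exact (isSpaceTimeTestOn_fderiv_newtonNearPotential_top hg h₀ h₁ c).contDiff_uncurry_heatDuhamelBack_infty
      one_pos
  · rw [hL]
    exact (isSpaceTimeTestOn_newtonFarSmoothing_top (hg.fderiv_apply_top c) h₀ h₁).contDiff_uncurry_heatDuhamelBack_infty
      one_pos

include hns hφ hg h₀ h₁ hη hΞ hL in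
/-- **The master identity of the caloric duality argument** (see the module docstring for the
statement and its derivation: the momentum equation tested with `ψ = (φη)c`, the backward heat
equation `∂ₜη + Δη = -g`, and the pressure equation tested with `ϑ = φΞ` with `ΔΞ = ∂_cη - L`).
[cite: SereginSverak2009, §2 (regularity inside Q₁), mechanism LemarieRieusset2016 (13.19)] -/
theorem integral_cutoff_mul_test_mul_inner_eq :
    ∫ z in (Q : Set (ℝ × EuclideanSpace ℝ (Fin 3))), φ z.1 z.2 * g z.1 z.2 * ⟪u z.1 z.2, c⟫ =
      (∫ z in (Q : Set (ℝ × EuclideanSpace ℝ (Fin 3))),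
          (timeDeriv φ z.1 z.2 + (Δ (φ z.1)) z.2) * ⟪u z.1 z.2, c⟫ * η z.1 z.2)
      + (∑ i, ∫ z in (Q : Set (ℝ × EuclideanSpace ℝ (Fin 3))),
          (2 * fderiv ℝ (φ z.1) z.2 (b i)) * ⟪u z.1 z.2, c⟫ * fderiv ℝ (η z.1) z.2 (b i))
      + (∑ i, ∫ z in (Q : Set (ℝ × EuclideanSpace ℝ (Fin 3))),
          fderiv ℝ (φ z.1) z.2 (b i) * (⟪u z.1 z.2, b i⟫ * ⟪u z.1 z.2, c⟫) * η z.1 z.2)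
      + (∑ i, ∫ z in (Q : Set (ℝ × EuclideanSpace ℝ (Fin 3))),
          φ z.1 z.2 * (⟪u z.1 z.2, b i⟫ * ⟪u z.1 z.2, c⟫) * fderiv ℝ (η z.1) z.2 (b i))
      + (∫ z in (Q : Set (ℝ × EuclideanSpace ℝ (Fin 3))),
          fderiv ℝ (φ z.1) z.2 c * p z.1 z.2 * η z.1 z.2)
      + (∫ z in (Q : Set (ℝ × EuclideanSpace ℝ (Fin 3))), φ z.1 z.2 * p z.1 z.2 * L z.1 z.2)
      + (∫ z in (Q : Set (ℝ × EuclideanSpace ℝ (Fin 3))),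
          (-(Δ (φ z.1)) z.2) * p z.1 z.2 * Ξ z.1 z.2)
      + (∑ i, ∫ z in (Q : Set (ℝ × EuclideanSpace ℝ (Fin 3))),
          (-(2 * fderiv ℝ (φ z.1) z.2 (b i))) * p z.1 z.2 * fderiv ℝ (Ξ z.1) z.2 (b i))
      + (∑ i, ∑ j, ∫ z in (Q : Set (ℝ × EuclideanSpace ℝ (Fin 3))),
          (-(φ z.1 z.2)) * (⟪u z.1 z.2, b i⟫ * ⟪u z.1 z.2, b j⟫) *
            fderiv ℝ (fun y => fderiv ℝ (Ξ z.1) y (b i)) z.2 (b j))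
      + (∑ i, ∑ j, ∫ z in (Q : Set (ℝ × EuclideanSpace ℝ (Fin 3))),
          (-(fderiv ℝ (fun y => fderiv ℝ (φ z.1) y (b i)) z.2 (b j))) * (⟪u z.1 z.2, b i⟫ * ⟪u z.1 z.2, b j⟫) *
            Ξ z.1 z.2)
      + (∑ i, ∑ j, ∫ z in (Q : Set (ℝ × EuclideanSpace ℝ (Fin 3))),
          (-(2 * fderiv ℝ (φ z.1) z.2 (b j))) * (⟪u z.1 z.2, b j⟫ * ⟪u z.1 z.2, b i⟫) *
            fderiv ℝ (Ξ z.1) z.2 (b i)) := by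
  classical
  obtain ⟨hηs, hΞs, hLs⟩ := contDiff_uncurry_caloric_fields (c := c) hg h₀ h₁ hη hΞ hL
  have hu := hns.1
  have hu2 := hns.2.1
  have hp := hns.2.2.1
  have hmom := hns.2.2.2.2
  set K : Set (ℝ × EuclideanSpace ℝ (Fin 3)) := tsupport (uncurry φ) with hK_def
  have hK : IsCompact K := hφ.hasCompactSupport
  have hKQ : K ⊆ (Q : Set (ℝ × EuclideanSpace ℝ (Fin 3))) := hφ.tsupport_subset
  -- smoothness of slices
  have hφ2 : ∀ t, ContDiff ℝ 2 (φ t) := fun t => (hφ.contDiff_slice t).of_le two_le_infty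
  have hη2 : ∀ t, ContDiff ℝ 2 (η t) := fun t => (contDiff_slice_of_uncurry hηs t).of_le two_le_infty
  have hΞ2 : ∀ t, ContDiff ℝ 2 (Ξ t) := fun t => (contDiff_slice_of_uncurry hΞs t).of_le two_le_infty
  /- ### continuity of the factors -/
  have cφ : Continuous fun z : ℝ × EuclideanSpace ℝ (Fin 3) => φ z.1 z.2 := hφ.contDiff.continuous
  have cφt : Continuous fun z : ℝ × EuclideanSpace ℝ (Fin 3) => timeDeriv φ z.1 z.2 :=
    hφ.continuous_timeDeriv
  have cφΔ : Continuous fun z : ℝ × EuclideanSpace ℝ (Fin 3) => (Δ (φ z.1)) z.2 := by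
    have h := ((hφ.isSmoothSpaceTimeOn univ).laplacian uniqueDiffOn_univ).continuousOn
    rw [univ_prod_univ, continuousOn_univ] at h
    exact h
  have cφi : ∀ v : EuclideanSpace ℝ (Fin 3),
      Continuous fun z : ℝ × EuclideanSpace ℝ (Fin 3) => fderiv ℝ (φ z.1) z.2 v := fun v =>
    continuous_fderiv_slice_of_contDiff hφ.contDiff v
  have cφij : ∀ v w : EuclideanSpace ℝ (Fin 3), Continuous fun z : ℝ × EuclideanSpace ℝ (Fin 3) =>
      fderiv ℝ (fun y => fderiv ℝ (φ z.1) y v) z.2 w :=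
    fun v w => hφ.continuous_fderiv_fderiv_slice v w
  have cη : Continuous fun z : ℝ × EuclideanSpace ℝ (Fin 3) => η z.1 z.2 := hηs.continuous
  have cηi : ∀ v : EuclideanSpace ℝ (Fin 3),
      Continuous fun z : ℝ × EuclideanSpace ℝ (Fin 3) => fderiv ℝ (η z.1) z.2 v := fun v =>
    continuous_fderiv_slice_of_contDiff hηs v
  have cΞ : Continuous fun z : ℝ × EuclideanSpace ℝ (Fin 3) => Ξ z.1 z.2 := hΞs.continuous
  have cΞi : ∀ v : EuclideanSpace ℝ (Fin 3),
      Continuous fun z : ℝ × EuclideanSpace ℝ (Fin 3) => fderiv ℝ (Ξ z.1) z.2 v := fun v =>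
    continuous_fderiv_slice_of_contDiff hΞs v
  have cΞij : ∀ v w : EuclideanSpace ℝ (Fin 3), Continuous fun z : ℝ × EuclideanSpace ℝ (Fin 3) =>
      fderiv ℝ (fun y => fderiv ℝ (Ξ z.1) y v) z.2 w :=
    fun v w => continuous_fderiv_slice_of_contDiff (contDiff_uncurry_fderiv_slice_apply hΞs v) w
  have cL : Continuous fun z : ℝ × EuclideanSpace ℝ (Fin 3) => L z.1 z.2 := hLs.continuous
  have cg : Continuous fun z : ℝ × EuclideanSpace ℝ (Fin 3) => g z.1 z.2 := hg.contDiff.continuous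
  have cp1 : Continuous fun _ : ℝ × EuclideanSpace ℝ (Fin 3) => (1 : ℝ) := continuous_const
  /- ### vanishing of the cut-off factors off `K` -/
  have zφ : ∀ z : ℝ × EuclideanSpace ℝ (Fin 3), z ∉ K → φ z.1 z.2 = 0 := fun z hz =>
    show uncurry φ z = 0 from image_eq_zero_of_notMem_tsupport hz
  have zφt : ∀ z : ℝ × EuclideanSpace ℝ (Fin 3), z ∉ K → timeDeriv φ z.1 z.2 + (Δ (φ z.1)) z.2 = 0 :=
    fun z hz => by
    rw [IsSpaceTimeTestOn.timeDeriv_eq_zero_of_notMem hz, laplacian_slice_eq_zero_of_notMem_tsupport hz,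
      add_zero]
  have zφi : ∀ (v : EuclideanSpace ℝ (Fin 3)) (z : ℝ × EuclideanSpace ℝ (Fin 3)), z ∉ K →
      fderiv ℝ (φ z.1) z.2 v = 0 := fun v z hz => by
    rw [IsSpaceTimeTestOn.fderiv_slice_eq_zero_of_notMem hz]; rfl
  have zφij : ∀ (v w : EuclideanSpace ℝ (Fin 3)) (z : ℝ × EuclideanSpace ℝ (Fin 3)), z ∉ K →
      fderiv ℝ (fun y => fderiv ℝ (φ z.1) y v) z.2 w = 0 := fun v w z hz =>
    fderiv_fderiv_slice_eq_zero_of_notMem_tsupport hz v w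
  /- ### integrability of the basic monomials on `K` -/
  have mu : ∀ a : EuclideanSpace ℝ (Fin 3),
      IntegrableOn (fun z : ℝ × EuclideanSpace ℝ (Fin 3) => ⟪u z.1 z.2, a⟫) K volume := fun a =>
    integrableOn_inner_of_locallyIntegrableOn hK hKQ hu a
  have muu : ∀ a a' : EuclideanSpace ℝ (Fin 3), IntegrableOn
      (fun z : ℝ × EuclideanSpace ℝ (Fin 3) => ⟪u z.1 z.2, a⟫ * ⟪u z.1 z.2, a'⟫) K volume :=
    fun a a' => integrableOn_inner_mul_inner_of_locallyIntegrableOn hK hKQ hu hu2 a a'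
  have mp : IntegrableOn (fun z : ℝ × EuclideanSpace ℝ (Fin 3) => p z.1 z.2) K volume :=
    hp.integrableOn_compact_subset hKQ hK
  -- a generic integrability statement
  have INT : ∀ {T m X : ℝ × EuclideanSpace ℝ (Fin 3) → ℝ}, Continuous T → (∀ z, z ∉ K → T z = 0) →
      IntegrableOn m K volume → Continuous X →
      IntegrableOn (fun z => T z * m z * X z) (Q : Set (ℝ × EuclideanSpace ℝ (Fin 3))) volume :=
    fun hT hT0 hm hX => integrableOn_test_mul_mul Q hK hT hT0 hm hX
  /- ### Step V: the momentum equation tested with `ψ = (φη)c` -/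
  set ψ : ℝ → EuclideanSpace ℝ (Fin 3) → EuclideanSpace ℝ (Fin 3) := fun t x => (φ t x * η t x) • c
    with hψ_def
  have hψ : IsSpaceTimeTestOn Q ψ := (hφ.mul_smooth hηs).smul_const' c
  have keyV := hmom ψ hψ
  -- the backward heat equation
  have heat : ∀ t x, timeDeriv η t x + (Δ (η t)) x = -g t x := fun t x => by
    rw [hη]; exact timeDeriv_add_laplacian_heatDuhamelBack_one hg t x
  -- the pointwise integrands
  set AV : ℝ × EuclideanSpace ℝ (Fin 3) → ℝ := fun z =>
    (timeDeriv φ z.1 z.2 + (Δ (φ z.1)) z.2) * ⟪u z.1 z.2, c⟫ * η z.1 z.2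
      + ∑ i, (2 * fderiv ℝ (φ z.1) z.2 (b i)) * ⟪u z.1 z.2, c⟫ * fderiv ℝ (η z.1) z.2 (b i)
      + ∑ i, fderiv ℝ (φ z.1) z.2 (b i) * (⟪u z.1 z.2, b i⟫ * ⟪u z.1 z.2, c⟫) * η z.1 z.2
      + ∑ i, φ z.1 z.2 * (⟪u z.1 z.2, b i⟫ * ⟪u z.1 z.2, c⟫) * fderiv ℝ (η z.1) z.2 (b i)
      + fderiv ℝ (φ z.1) z.2 c * p z.1 z.2 * η z.1 z.2 with hAV
  set P6 : ℝ × EuclideanSpace ℝ (Fin 3) → ℝ := fun z =>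
    φ z.1 z.2 * p z.1 z.2 * fderiv ℝ (η z.1) z.2 c with hP6
  set LH : ℝ × EuclideanSpace ℝ (Fin 3) → ℝ := fun z =>
    φ z.1 z.2 * g z.1 z.2 * ⟪u z.1 z.2, c⟫ with hLH
  have hptV : ∀ z : ℝ × EuclideanSpace ℝ (Fin 3),
      ⟪u z.1 z.2, timeDeriv ψ z.1 z.2⟫ + ⟪u z.1 z.2, convect (u z.1) (ψ z.1) z.2⟫ +
        1 * ⟪u z.1 z.2, (Δ (ψ z.1)) z.2⟫ + p z.1 z.2 * VectorCalculus.divergence (ψ z.1) z.2 +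
        ⟪(0 : ℝ → EuclideanSpace ℝ (Fin 3) → EuclideanSpace ℝ (Fin 3)) z.1 z.2, ψ z.1 z.2⟫ =
      AV z + P6 z - LH z := by
    rintro ⟨t, x⟩
    have e1 : timeDeriv ψ t x = (timeDeriv φ t x * η t x + φ t x * timeDeriv η t x) • c :=
      timeDeriv_mulSmul hφ.contDiff hηs c t x
    have e2 : convect (u t) (ψ t) x =
        (fderiv ℝ (φ t) x (u t x) * η t x + φ t x * fderiv ℝ (η t) x (u t x)) • c :=
      convect_mulSmul hφ.contDiff hηs c (u t) t x
    have e3 : (Δ (ψ t)) x = (φ t x * (Δ (η t)) x + η t x * (Δ (φ t)) x +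
        2 * ∑ i, fderiv ℝ (φ t) x (b i) * fderiv ℝ (η t) x (b i)) • c :=
      laplacian_mulSmul b hφ.contDiff hηs c t x
    have e4 : VectorCalculus.divergence (ψ t) x = fderiv ℝ (φ t) x c * η t x + φ t x * fderiv ℝ (η t) x c :=
      divergence_mulSmul hφ.contDiff hηs c t x
    have e5 : fderiv ℝ (φ t) x (u t x) = ∑ i, ⟪u t x, b i⟫ * fderiv ℝ (φ t) x (b i) :=
      fderiv_apply_eq_sum_inner b (φ t) x (u t x)
    have e6 : fderiv ℝ (η t) x (u t x) = ∑ i, ⟪u t x, b i⟫ * fderiv ℝ (η t) x (b i) :=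
      fderiv_apply_eq_sum_inner b (η t) x (u t x)
    have e7 := heat t x
    simp only [hAV, hP6, hLH]
    rw [e1, e2, e3, e4]
    simp only [real_inner_smul_right, Pi.zero_apply, inner_zero_left, add_zero, one_mul]
    have E3 : 2 * (∑ i, fderiv ℝ (φ t) x (b i) * fderiv ℝ (η t) x (b i)) * ⟪u t x, c⟫ =
        ∑ i, 2 * fderiv ℝ (φ t) x (b i) * ⟪u t x, c⟫ * fderiv ℝ (η t) x (b i) := by
      rw [Finset.mul_sum, Finset.sum_mul]
      exact Finset.sum_congr rfl fun i _ => by ring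
    have E5 : fderiv ℝ (φ t) x (u t x) * η t x * ⟪u t x, c⟫ =
        ∑ i, fderiv ℝ (φ t) x (b i) * (⟪u t x, b i⟫ * ⟪u t x, c⟫) * η t x := by
      rw [e5, Finset.sum_mul, Finset.sum_mul]
      exact Finset.sum_congr rfl fun i _ => by ring
    have E6 : φ t x * fderiv ℝ (η t) x (u t x) * ⟪u t x, c⟫ =
        ∑ i, φ t x * (⟪u t x, b i⟫ * ⟪u t x, c⟫) * fderiv ℝ (η t) x (b i) := by
      rw [e6, Finset.mul_sum, Finset.sum_mul]
      exact Finset.sum_congr rfl fun i _ => by ring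
    linear_combination (φ t x * ⟪u t x, c⟫) * e7 + E5 + E6 + E3
  /- ### Step P: the pressure equation tested with `ϑ = φΞ` -/
  have hθ : IsSpaceTimeTestOn Q (fun t x => φ t x * Ξ t x) := hφ.mul_smooth hΞs
  have hf0 : LocallyIntegrableOn (uncurry (0 : ℝ → EuclideanSpace ℝ (Fin 3) → EuclideanSpace ℝ (Fin 3)))
      (Q : Set (ℝ × EuclideanSpace ℝ (Fin 3))) volume :=
    (locallyIntegrable_zero).locallyIntegrableOn _
  have hdiv0 : ∀ φ' : ℝ → EuclideanSpace ℝ (Fin 3) → ℝ, IsSpaceTimeTestOn Q φ' →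
      ∫ z in (Q : Set (ℝ × EuclideanSpace ℝ (Fin 3))),
        ⟪(0 : ℝ → EuclideanSpace ℝ (Fin 3) → EuclideanSpace ℝ (Fin 3)) z.1 z.2, gradient (φ' z.1) z.2⟫ = 0 :=
    fun φ' _ => by simp
  have keyP := hns.integral_hessian_add_pressure_laplacian_eq_zero hf0 hdiv0 hθ
  -- `ΔΞ = ∂_cη - L`
  have lapΞ : ∀ t x, (Δ (Ξ t)) x = fderiv ℝ (η t) x c - L t x := fun t x => by
    rw [hΞ, hη, hL]; exact laplacian_heatDuhamelBack_fderiv_newtonNearPotential hg h₀ h₁ c t x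
  set BV : ℝ × EuclideanSpace ℝ (Fin 3) → ℝ := fun z =>
    φ z.1 z.2 * p z.1 z.2 * L z.1 z.2
      + (-(Δ (φ z.1)) z.2) * p z.1 z.2 * Ξ z.1 z.2
      + ∑ i, (-(2 * fderiv ℝ (φ z.1) z.2 (b i))) * p z.1 z.2 * fderiv ℝ (Ξ z.1) z.2 (b i)
      + ∑ i, ∑ j, (-(φ z.1 z.2)) * (⟪u z.1 z.2, b i⟫ * ⟪u z.1 z.2, b j⟫) *
          fderiv ℝ (fun y => fderiv ℝ (Ξ z.1) y (b i)) z.2 (b j)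
      + ∑ i, ∑ j, (-(fderiv ℝ (fun y => fderiv ℝ (φ z.1) y (b i)) z.2 (b j))) *
          (⟪u z.1 z.2, b i⟫ * ⟪u z.1 z.2, b j⟫) * Ξ z.1 z.2
      + ∑ i, ∑ j, (-(2 * fderiv ℝ (φ z.1) z.2 (b j))) * (⟪u z.1 z.2, b j⟫ * ⟪u z.1 z.2, b i⟫) *
          fderiv ℝ (Ξ z.1) z.2 (b i) with hBV
  have hptP : ∀ z : ℝ × EuclideanSpace ℝ (Fin 3),
      fderiv ℝ (fderiv ℝ ((fun t x => φ t x * Ξ t x) z.1)) z.2 (u z.1 z.2) (u z.1 z.2) +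
        p z.1 z.2 * (Δ ((fun t x => φ t x * Ξ t x) z.1)) z.2 = P6 z - BV z := by
    rintro ⟨t, x⟩
    have hD : DifferentiableAt ℝ (fderiv ℝ (φ t)) x :=
      (((hφ2 t).fderiv_right (m := 1) le_rfl).differentiable one_ne_zero) x
    have p1 := hessian_mul_apply_apply (hφ2 t) (hΞ2 t) x (u t x)
    have p2 : fderiv ℝ (fun y => fderiv ℝ (Ξ t) y (u t x)) x (u t x) =
        ∑ i, ∑ j, (⟪u t x, b i⟫ * ⟪u t x, b j⟫) * fderiv ℝ (fun y => fderiv ℝ (Ξ t) y (b i)) x (b j) :=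
      fderiv_fderiv_apply_eq_sum b (hΞ2 t) x (u t x)
    have p3 : fderiv ℝ (fderiv ℝ (φ t)) x (u t x) (u t x) =
        ∑ i, ∑ j, (⟪u t x, b i⟫ * ⟪u t x, b j⟫) * fderiv ℝ (fun y => fderiv ℝ (φ t) y (b i)) x (b j) := by
      rw [← fderiv_apply_const_apply hD (u t x) (u t x)]
      exact fderiv_fderiv_apply_eq_sum b (hφ2 t) x (u t x)
    have p4 : fderiv ℝ (φ t) x (u t x) = ∑ j, ⟪u t x, b j⟫ * fderiv ℝ (φ t) x (b j) :=
      fderiv_apply_eq_sum_inner b (φ t) x (u t x)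
    have p5 : fderiv ℝ (Ξ t) x (u t x) = ∑ i, ⟪u t x, b i⟫ * fderiv ℝ (Ξ t) x (b i) :=
      fderiv_apply_eq_sum_inner b (Ξ t) x (u t x)
    have p6 := laplacian_mul_eq b (hφ2 t) (hΞ2 t) x
    have p7 := lapΞ t x
    simp only [hP6, hBV]
    change fderiv ℝ (fderiv ℝ (fun y => φ t y * Ξ t y)) x (u t x) (u t x) +
      p t x * (Δ (fun y => φ t y * Ξ t y)) x = _
    rw [p1, p2, p3, p4, p5, p6, p7]
    -- distribute
    have hs4 : (2 * ((∑ j, ⟪u t x, b j⟫ * fderiv ℝ (φ t) x (b j)) *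
        ∑ i, ⟪u t x, b i⟫ * fderiv ℝ (Ξ t) x (b i))) =
        -∑ i, ∑ j, (-(2 * fderiv ℝ (φ t) x (b j))) * (⟪u t x, b j⟫ * ⟪u t x, b i⟫) *
          fderiv ℝ (Ξ t) x (b i) := by
      rw [Finset.sum_mul_sum, Finset.sum_comm, Finset.mul_sum, ← Finset.sum_neg_distrib]
      refine Finset.sum_congr rfl fun i _ => ?_
      rw [Finset.mul_sum, ← Finset.sum_neg_distrib]
      refine Finset.sum_congr rfl fun j _ => ?_
      ring
    have hs5 : φ t x * ∑ i, ∑ j, ⟪u t x, b i⟫ * ⟪u t x, b j⟫ *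
        fderiv ℝ (fun y => fderiv ℝ (Ξ t) y (b i)) x (b j) =
        -∑ i, ∑ j, (-(φ t x)) * (⟪u t x, b i⟫ * ⟪u t x, b j⟫) *
          fderiv ℝ (fun y => fderiv ℝ (Ξ t) y (b i)) x (b j) := by
      rw [Finset.mul_sum, ← Finset.sum_neg_distrib]
      refine Finset.sum_congr rfl fun i _ => ?_
      rw [Finset.mul_sum, ← Finset.sum_neg_distrib]
      refine Finset.sum_congr rfl fun j _ => ?_
      ring
    have hs6 : Ξ t x * ∑ i, ∑ j, ⟪u t x, b i⟫ * ⟪u t x, b j⟫ *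
        fderiv ℝ (fun y => fderiv ℝ (φ t) y (b i)) x (b j) =
        -∑ i, ∑ j, (-(fderiv ℝ (fun y => fderiv ℝ (φ t) y (b i)) x (b j))) *
          (⟪u t x, b i⟫ * ⟪u t x, b j⟫) * Ξ t x := by
      rw [Finset.mul_sum, ← Finset.sum_neg_distrib]
      refine Finset.sum_congr rfl fun i _ => ?_
      rw [Finset.mul_sum, ← Finset.sum_neg_distrib]
      refine Finset.sum_congr rfl fun j _ => ?_
      ring
    have hs7 : p t x * (2 * ∑ i, fderiv ℝ (φ t) x (b i) * fderiv ℝ (Ξ t) x (b i)) =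
        -∑ i, (-(2 * fderiv ℝ (φ t) x (b i))) * p t x * fderiv ℝ (Ξ t) x (b i) := by
      rw [Finset.mul_sum, Finset.mul_sum, ← Finset.sum_neg_distrib]
      refine Finset.sum_congr rfl fun i _ => ?_
      ring
    have halg : φ t x * (∑ i, ∑ j, ⟪u t x, b i⟫ * ⟪u t x, b j⟫ *
          fderiv ℝ (fun y => fderiv ℝ (Ξ t) y (b i)) x (b j)) +
        Ξ t x * (∑ i, ∑ j, ⟪u t x, b i⟫ * ⟪u t x, b j⟫ *
          fderiv ℝ (fun y => fderiv ℝ (φ t) y (b i)) x (b j)) +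
        2 * ((∑ j, ⟪u t x, b j⟫ * fderiv ℝ (φ t) x (b j)) * ∑ i, ⟪u t x, b i⟫ * fderiv ℝ (Ξ t) x (b i)) +
        p t x * (φ t x * (fderiv ℝ (η t) x c - L t x) + Ξ t x * (Δ (φ t)) x +
          2 * ∑ i, fderiv ℝ (φ t) x (b i) * fderiv ℝ (Ξ t) x (b i)) =
        φ t x * p t x * fderiv ℝ (η t) x c -
          (φ t x * p t x * L t x + (-(Δ (φ t)) x) * p t x * Ξ t x +
            ∑ i, (-(2 * fderiv ℝ (φ t) x (b i))) * p t x * fderiv ℝ (Ξ t) x (b i) +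
            ∑ i, ∑ j, (-(φ t x)) * (⟪u t x, b i⟫ * ⟪u t x, b j⟫) *
              fderiv ℝ (fun y => fderiv ℝ (Ξ t) y (b i)) x (b j) +
            ∑ i, ∑ j, (-(fderiv ℝ (fun y => fderiv ℝ (φ t) y (b i)) x (b j))) *
              (⟪u t x, b i⟫ * ⟪u t x, b j⟫) * Ξ t x +
            ∑ i, ∑ j, (-(2 * fderiv ℝ (φ t) x (b j))) * (⟪u t x, b j⟫ * ⟪u t x, b i⟫) *
              fderiv ℝ (Ξ t) x (b i)) := by
      rw [hs5, hs6, hs4, mul_add (p t x), mul_add (p t x), hs7]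
      ring
    exact halg
  /- ### integrability of every term -/
  have iLH : IntegrableOn LH (Q : Set (ℝ × EuclideanSpace ℝ (Fin 3))) volume := by
    have h := INT cφ zφ (mu c) cg
    refine h.congr_fun (fun z _ => ?_) Q.isOpen.measurableSet
    simp only [hLH]; ring
  have iP6 : IntegrableOn P6 (Q : Set (ℝ × EuclideanSpace ℝ (Fin 3))) volume := INT cφ zφ mp (cηi c)
  have iA1 : IntegrableOn (fun z : ℝ × EuclideanSpace ℝ (Fin 3) =>
      (timeDeriv φ z.1 z.2 + (Δ (φ z.1)) z.2) * ⟪u z.1 z.2, c⟫ * η z.1 z.2) Q volume :=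
    INT (cφt.add cφΔ) zφt (mu c) cη
  have iA2 : ∀ i, IntegrableOn (fun z : ℝ × EuclideanSpace ℝ (Fin 3) =>
      (2 * fderiv ℝ (φ z.1) z.2 (b i)) * ⟪u z.1 z.2, c⟫ * fderiv ℝ (η z.1) z.2 (b i)) Q volume := fun i =>
    INT (continuous_const.mul (cφi (b i))) (fun z hz => by rw [zφi (b i) z hz, mul_zero]) (mu c) (cηi (b i))
  have iA3 : ∀ i, IntegrableOn (fun z : ℝ × EuclideanSpace ℝ (Fin 3) =>
      fderiv ℝ (φ z.1) z.2 (b i) * (⟪u z.1 z.2, b i⟫ * ⟪u z.1 z.2, c⟫) * η z.1 z.2) Q volume := fun i =>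
    INT (cφi (b i)) (zφi (b i)) (muu (b i) c) cη
  have iA4 : ∀ i, IntegrableOn (fun z : ℝ × EuclideanSpace ℝ (Fin 3) =>
      φ z.1 z.2 * (⟪u z.1 z.2, b i⟫ * ⟪u z.1 z.2, c⟫) * fderiv ℝ (η z.1) z.2 (b i)) Q volume := fun i =>
    INT cφ zφ (muu (b i) c) (cηi (b i))
  have iA5 : IntegrableOn (fun z : ℝ × EuclideanSpace ℝ (Fin 3) =>
      fderiv ℝ (φ z.1) z.2 c * p z.1 z.2 * η z.1 z.2) Q volume := INT (cφi c) (zφi c) mp cη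
  have iB1 : IntegrableOn (fun z : ℝ × EuclideanSpace ℝ (Fin 3) => φ z.1 z.2 * p z.1 z.2 * L z.1 z.2) Q
      volume := INT cφ zφ mp cL
  have iB2 : IntegrableOn (fun z : ℝ × EuclideanSpace ℝ (Fin 3) =>
      (-(Δ (φ z.1)) z.2) * p z.1 z.2 * Ξ z.1 z.2) Q volume :=
    INT cφΔ.neg (fun z hz => by rw [laplacian_slice_eq_zero_of_notMem_tsupport hz, neg_zero]) mp cΞ
  have iB3 : ∀ i, IntegrableOn (fun z : ℝ × EuclideanSpace ℝ (Fin 3) =>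
      (-(2 * fderiv ℝ (φ z.1) z.2 (b i))) * p z.1 z.2 * fderiv ℝ (Ξ z.1) z.2 (b i)) Q volume := fun i =>
    INT (continuous_const.mul (cφi (b i))).neg
      (fun z hz => by rw [zφi (b i) z hz, mul_zero, neg_zero]) mp (cΞi (b i))
  have iB4 : ∀ i j, IntegrableOn (fun z : ℝ × EuclideanSpace ℝ (Fin 3) =>
      (-(φ z.1 z.2)) * (⟪u z.1 z.2, b i⟫ * ⟪u z.1 z.2, b j⟫) *
        fderiv ℝ (fun y => fderiv ℝ (Ξ z.1) y (b i)) z.2 (b j)) Q volume := fun i j =>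
    INT cφ.neg (fun z hz => by rw [zφ z hz, neg_zero]) (muu (b i) (b j)) (cΞij (b i) (b j))
  have iB5 : ∀ i j, IntegrableOn (fun z : ℝ × EuclideanSpace ℝ (Fin 3) =>
      (-(fderiv ℝ (fun y => fderiv ℝ (φ z.1) y (b i)) z.2 (b j))) * (⟪u z.1 z.2, b i⟫ * ⟪u z.1 z.2, b j⟫) *
        Ξ z.1 z.2) Q volume := fun i j =>
    INT (cφij (b i) (b j)).neg (fun z hz => by rw [zφij (b i) (b j) z hz, neg_zero])
      (muu (b i) (b j)) cΞ
  have iB6 : ∀ i j, IntegrableOn (fun z : ℝ × EuclideanSpace ℝ (Fin 3) =>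
      (-(2 * fderiv ℝ (φ z.1) z.2 (b j))) * (⟪u z.1 z.2, b j⟫ * ⟪u z.1 z.2, b i⟫) *
        fderiv ℝ (Ξ z.1) z.2 (b i)) Q volume := fun i j =>
    INT (continuous_const.mul (cφi (b j))).neg
      (fun z hz => by rw [zφi (b j) z hz, mul_zero, neg_zero]) (muu (b j) (b i)) (cΞi (b i))
  -- integrability of the sums
  have iA2s : IntegrableOn (fun z : ℝ × EuclideanSpace ℝ (Fin 3) =>
      ∑ i, (2 * fderiv ℝ (φ z.1) z.2 (b i)) * ⟪u z.1 z.2, c⟫ * fderiv ℝ (η z.1) z.2 (b i)) Q volume :=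
    integrable_finsetSum _ fun i _ => iA2 i
  have iA3s : IntegrableOn (fun z : ℝ × EuclideanSpace ℝ (Fin 3) =>
      ∑ i, fderiv ℝ (φ z.1) z.2 (b i) * (⟪u z.1 z.2, b i⟫ * ⟪u z.1 z.2, c⟫) * η z.1 z.2) Q volume :=
    integrable_finsetSum _ fun i _ => iA3 i
  have iA4s : IntegrableOn (fun z : ℝ × EuclideanSpace ℝ (Fin 3) =>
      ∑ i, φ z.1 z.2 * (⟪u z.1 z.2, b i⟫ * ⟪u z.1 z.2, c⟫) * fderiv ℝ (η z.1) z.2 (b i)) Q volume :=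
    integrable_finsetSum _ fun i _ => iA4 i
  have iB3s : IntegrableOn (fun z : ℝ × EuclideanSpace ℝ (Fin 3) =>
      ∑ i, (-(2 * fderiv ℝ (φ z.1) z.2 (b i))) * p z.1 z.2 * fderiv ℝ (Ξ z.1) z.2 (b i)) Q volume :=
    integrable_finsetSum _ fun i _ => iB3 i
  have iB4s : IntegrableOn (fun z : ℝ × EuclideanSpace ℝ (Fin 3) =>
      ∑ i, ∑ j, (-(φ z.1 z.2)) * (⟪u z.1 z.2, b i⟫ * ⟪u z.1 z.2, b j⟫) *
        fderiv ℝ (fun y => fderiv ℝ (Ξ z.1) y (b i)) z.2 (b j)) Q volume :=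
    integrable_finsetSum _ fun i _ => integrable_finsetSum _ fun j _ => iB4 i j
  have iB5s : IntegrableOn (fun z : ℝ × EuclideanSpace ℝ (Fin 3) =>
      ∑ i, ∑ j, (-(fderiv ℝ (fun y => fderiv ℝ (φ z.1) y (b i)) z.2 (b j))) *
        (⟪u z.1 z.2, b i⟫ * ⟪u z.1 z.2, b j⟫) * Ξ z.1 z.2) Q volume :=
    integrable_finsetSum _ fun i _ => integrable_finsetSum _ fun j _ => iB5 i j
  have iB6s : IntegrableOn (fun z : ℝ × EuclideanSpace ℝ (Fin 3) =>
      ∑ i, ∑ j, (-(2 * fderiv ℝ (φ z.1) z.2 (b j))) * (⟪u z.1 z.2, b j⟫ * ⟪u z.1 z.2, b i⟫) *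
        fderiv ℝ (Ξ z.1) z.2 (b i)) Q volume :=
    integrable_finsetSum _ fun i _ => integrable_finsetSum _ fun j _ => iB6 i j
  have iAV : IntegrableOn AV (Q : Set (ℝ × EuclideanSpace ℝ (Fin 3))) volume :=
    (((iA1.fun_add iA2s).fun_add iA3s).fun_add iA4s).fun_add iA5
  have iBV : IntegrableOn BV (Q : Set (ℝ × EuclideanSpace ℝ (Fin 3))) volume :=
    ((((iB1.fun_add iB2).fun_add iB3s).fun_add iB4s).fun_add iB5s).fun_add iB6s
  /- ### integrate the two pointwise identities -/
  have intV : ∫ z in (Q : Set (ℝ × EuclideanSpace ℝ (Fin 3))), (AV z + P6 z - LH z) = 0 := by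
    rw [← keyV]
    exact setIntegral_congr_fun Q.isOpen.measurableSet fun z _ => (hptV z).symm
  have intP : ∫ z in (Q : Set (ℝ × EuclideanSpace ℝ (Fin 3))), (P6 z - BV z) = 0 := by
    rw [← keyP]
    exact setIntegral_congr_fun Q.isOpen.measurableSet fun z _ => (hptP z).symm
  rw [integral_sub (iAV.fun_add iP6) iLH, integral_add iAV iP6] at intV
  rw [integral_sub iP6 iBV] at intP
  have main : ∫ z in (Q : Set (ℝ × EuclideanSpace ℝ (Fin 3))), LH z =
      (∫ z in (Q : Set (ℝ × EuclideanSpace ℝ (Fin 3))), AV z) +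
        ∫ z in (Q : Set (ℝ × EuclideanSpace ℝ (Fin 3))), BV z := by linarith
  -- expand the two integrals of sums
  have hA : ∫ z in (Q : Set (ℝ × EuclideanSpace ℝ (Fin 3))), AV z =
      (∫ z in (Q : Set (ℝ × EuclideanSpace ℝ (Fin 3))),
          (timeDeriv φ z.1 z.2 + (Δ (φ z.1)) z.2) * ⟪u z.1 z.2, c⟫ * η z.1 z.2)
      + (∑ i, ∫ z in (Q : Set (ℝ × EuclideanSpace ℝ (Fin 3))),
          (2 * fderiv ℝ (φ z.1) z.2 (b i)) * ⟪u z.1 z.2, c⟫ * fderiv ℝ (η z.1) z.2 (b i))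
      + (∑ i, ∫ z in (Q : Set (ℝ × EuclideanSpace ℝ (Fin 3))),
          fderiv ℝ (φ z.1) z.2 (b i) * (⟪u z.1 z.2, b i⟫ * ⟪u z.1 z.2, c⟫) * η z.1 z.2)
      + (∑ i, ∫ z in (Q : Set (ℝ × EuclideanSpace ℝ (Fin 3))),
          φ z.1 z.2 * (⟪u z.1 z.2, b i⟫ * ⟪u z.1 z.2, c⟫) * fderiv ℝ (η z.1) z.2 (b i))
      + (∫ z in (Q : Set (ℝ × EuclideanSpace ℝ (Fin 3))),
          fderiv ℝ (φ z.1) z.2 c * p z.1 z.2 * η z.1 z.2) := by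
    simp only [hAV]
    rw [integral_add (((iA1.fun_add iA2s).fun_add iA3s).fun_add iA4s) iA5,
      integral_add ((iA1.fun_add iA2s).fun_add iA3s) iA4s, integral_add (iA1.fun_add iA2s) iA3s,
      integral_add iA1 iA2s, integral_finsetSum _ (fun i _ => iA2 i),
      integral_finsetSum _ (fun i _ => iA3 i), integral_finsetSum _ (fun i _ => iA4 i)]
  have hB : ∫ z in (Q : Set (ℝ × EuclideanSpace ℝ (Fin 3))), BV z =
      (∫ z in (Q : Set (ℝ × EuclideanSpace ℝ (Fin 3))), φ z.1 z.2 * p z.1 z.2 * L z.1 z.2)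
      + (∫ z in (Q : Set (ℝ × EuclideanSpace ℝ (Fin 3))),
          (-(Δ (φ z.1)) z.2) * p z.1 z.2 * Ξ z.1 z.2)
      + (∑ i, ∫ z in (Q : Set (ℝ × EuclideanSpace ℝ (Fin 3))),
          (-(2 * fderiv ℝ (φ z.1) z.2 (b i))) * p z.1 z.2 * fderiv ℝ (Ξ z.1) z.2 (b i))
      + (∑ i, ∑ j, ∫ z in (Q : Set (ℝ × EuclideanSpace ℝ (Fin 3))),
          (-(φ z.1 z.2)) * (⟪u z.1 z.2, b i⟫ * ⟪u z.1 z.2, b j⟫) *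
            fderiv ℝ (fun y => fderiv ℝ (Ξ z.1) y (b i)) z.2 (b j))
      + (∑ i, ∑ j, ∫ z in (Q : Set (ℝ × EuclideanSpace ℝ (Fin 3))),
          (-(fderiv ℝ (fun y => fderiv ℝ (φ z.1) y (b i)) z.2 (b j))) * (⟪u z.1 z.2, b i⟫ * ⟪u z.1 z.2, b j⟫) *
            Ξ z.1 z.2)
      + (∑ i, ∑ j, ∫ z in (Q : Set (ℝ × EuclideanSpace ℝ (Fin 3))),
          (-(2 * fderiv ℝ (φ z.1) z.2 (b j))) * (⟪u z.1 z.2, b j⟫ * ⟪u z.1 z.2, b i⟫) *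
            fderiv ℝ (Ξ z.1) z.2 (b i)) := by
    simp only [hBV]
    rw [integral_add ((((iB1.fun_add iB2).fun_add iB3s).fun_add iB4s).fun_add iB5s) iB6s,
      integral_add (((iB1.fun_add iB2).fun_add iB3s).fun_add iB4s) iB5s,
      integral_add ((iB1.fun_add iB2).fun_add iB3s) iB4s, integral_add (iB1.fun_add iB2) iB3s,
      integral_add iB1 iB2, integral_finsetSum _ (fun i _ => iB3 i),
      integral_finsetSum _ (fun i _ => integrable_finsetSum _ fun j _ => iB4 i j),
      integral_finsetSum _ (fun i _ => integrable_finsetSum _ fun j _ => iB5 i j),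
      integral_finsetSum _ (fun i _ => integrable_finsetSum _ fun j _ => iB6 i j),
      Finset.sum_congr rfl fun i _ => integral_finsetSum _ (fun j _ => iB4 i j),
      Finset.sum_congr rfl fun i _ => integral_finsetSum _ (fun j _ => iB5 i j),
      Finset.sum_congr rfl fun i _ => integral_finsetSum _ (fun j _ => iB6 i j)]
  have hLHS : (∫ z in (Q : Set (ℝ × EuclideanSpace ℝ (Fin 3))), φ z.1 z.2 * g z.1 z.2 * ⟪u z.1 z.2, c⟫) =
      ∫ z in (Q : Set (ℝ × EuclideanSpace ℝ (Fin 3))), LH z := rfl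
  rw [hLHS, main, hA, hB]
  ring

end Master

end Literature.Analysis.FluidPDE
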